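import Literature.Topology.FourManifolds.ImmersionCriterion
import Literature.Topology.FourManifolds.EquidimensionalEmbedding
import Mathlib.Topology.IsLocalHomeomorph
import Mathlib.Geometry.Manifold.LocalDiffeomorph
import Mathlib.Geometry.Manifold.SmoothEmbedding

/-!
# Origami fold existence, line `stable-seam-host`: the composite disc is a smooth embedding

Crux `stmt-SmoothPoincare4-7844` (`OrigamiFoldExistence`), brick C for the shield
`helper_stableSeamV2_of_smoothPoincare4`.  The host embeddings `J : S → X` of the line are only
`C^∞`, injective and immersive on an open set `U ⊆ S`; this file proves that for a smooth
embedding `F : ℝ⁴ → S` of the whole model space with `range F ⊆ U`, the composite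
`J ∘ F : ℝ⁴ → X` is a smooth embedding in Mathlib's chart sense
(`Manifold.IsSmoothEmbedding (𝓡 4) (𝓡 4) ∞`).

Proof: `J ∘ F` is `C^∞` (`ContMDiffOn.comp_contMDiff`) and injective; its differential is
everywhere injective, since `dF_x` is an isomorphism (`F` is an equidimensional smooth embedding,
hence a local diffeomorphism, `Manifold.IsSmoothEmbedding.isLocalDiffeomorph_of_finrank_eq`) and
`dJ_{F x}` is bijective on `U`.  By the tree's immersion criterion
(`Literature.Topology.FourManifolds.isImmersion_of_injective_mfderiv`, Lee 2013, Thm. 4.12 /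
Prop. 5.22) `J ∘ F` is an immersion, hence (equal dimensions,
`Manifold.IsImmersion.isLocalDiffeomorph_of_finrank_eq`, Hirsch 1976, Ch. 1 §3) a local
diffeomorphism, so an injective local homeomorphism, i.e. an open topological embedding
(`IsLocalHomeomorph.isOpenEmbedding_of_injective`).

## References

* J. M. Lee, *Introduction to Smooth Manifolds*, 2nd ed., GTM 218 (2013), Ch. 4–5.
* M. W. Hirsch, *Differential Topology*, GTM 33 (1976), Ch. 1 §3.
-/

noncomputable section

set_option linter.dupNamespace false

open scoped Manifold ContDiff Topology

namespace Summit.SmoothPoincare4.SmoothPoincare4.Theorems.OrigamiFoldExistence.StableSeamHost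

/-- **The composite disc is a smooth embedding.**  Let `S`, `X` be smooth `4`-manifolds
(charted on `ℝ⁴`), `F : ℝ⁴ → S` a smooth embedding, and `J : S → X` a map which is `C^∞`,
injective and has bijective differential on an open set `U ⊇ range F`.  Then `J ∘ F : ℝ⁴ → X` is
a smooth embedding (`Manifold.IsSmoothEmbedding`): it is `C^∞`, injective, with everywhere
injective differential (chain rule, `dF_x` an isomorphism as `F` is an equidimensional smooth
embedding), hence an immersion (immersion criterion) and, the dimensions being equal, a local
diffeomorphism; an injective local homeomorphism is an open embedding. [folklore] -/
theorem helper_isSmoothEmbedding_comp_of_range_subset : ∀ (S : Type) [TopologicalSpace S] [T2Space S] [SecondCountableTopology S] [ChartedSpace (EuclideanSpace ℝ (Fin 4)) S] [IsManifold (𝓡 4) ∞ S] (X : Type) [TopologicalSpace X] [T2Space X] [SecondCountableTopology X] [ChartedSpace (EuclideanSpace ℝ (Fin 4)) X] [IsManifold (𝓡 4) ∞ X] (F : EuclideanSpace ℝ (Fin 4) → S) (J : S → X) (U : Set S), Manifold.IsSmoothEmbedding (𝓡 4) (𝓡 4) ∞ F → IsOpen U → Set.range F ⊆ U → ContMDiffOn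 (𝓡 4) (𝓡 4) ∞ J U → Set.InjOn J U → (∀ x ∈ U, Function.Bijective (mfderiv (𝓡 4) (𝓡 4) J x)) → Manifold.IsSmoothEmbedding (𝓡 4) (𝓡 4) ∞ (J ∘ F) := by
  intro S _ _ _ _ _ X _ _ _ _ _ F J U hF hUopen hU hJ hinj hbij
  have hmem : ∀ x, F x ∈ U := fun x => hU ⟨x, rfl⟩
  -- (1) the composite is `C^∞`
  have hJF : ContMDiff (𝓡 4) (𝓡 4) ∞ (J ∘ F) := hJ.comp_contMDiff hF.contMDiff hmem
  -- (2) the composite is injective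
  have hinjJF : Function.Injective (J ∘ F) := fun x y hxy =>
    hF.isEmbedding.injective (hinj (hmem x) (hmem y) hxy)
  -- (3) the composite has everywhere injective differential
  have hFld : IsLocalDiffeomorph (𝓡 4) (𝓡 4) ∞ F := hF.isLocalDiffeomorph_of_finrank_eq rfl
  have hd : ∀ x, Function.Injective (mfderiv (𝓡 4) (𝓡 4) (J ∘ F) x) := by
    intro x
    have hJx : MDifferentiableAt (𝓡 4) (𝓡 4) J (F x) :=
      ((hJ (F x) (hmem x)).contMDiffAt (hUopen.mem_nhds (hmem x))).mdifferentiableAt (by simp)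
    have hFx : MDifferentiableAt (𝓡 4) (𝓡 4) F x := (hF.contMDiff x).mdifferentiableAt (by simp)
    have hFinj : Function.Injective (mfderiv (𝓡 4) (𝓡 4) F x) :=
      ((hFld x).mfderivToContinuousLinearEquiv (by simp)).injective
    rw [mfderiv_comp x hJx hFx]
    exact (hbij (F x) (hmem x)).1.comp hFinj
  -- (4) hence an immersion, (5) hence (equal dimensions) a local diffeomorphism
  have himm : Manifold.IsImmersion (𝓡 4) (𝓡 4) ∞ (J ∘ F) :=
    Literature.Topology.FourManifolds.isImmersion_of_injective_mfderiv hJF (by simp) hd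
  have hld : IsLocalDiffeomorph (𝓡 4) (𝓡 4) ∞ (J ∘ F) := himm.isLocalDiffeomorph_of_finrank_eq rfl
  -- (6) an injective local homeomorphism is an (open) embedding
  exact ⟨himm, (hld.isLocalHomeomorph.isOpenEmbedding_of_injective hinjJF).isEmbedding⟩

end Summit.SmoothPoincare4.SmoothPoincare4.Theorems.OrigamiFoldExistence.StableSeamHost

end
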